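import Mathlib.Data.Nat.Prime.Basic
import Mathlib.Data.List.Sort
import Mathlib.Tactic.Linarith
import Mathlib.Tactic.Ring
import HarnessLib

/-!
# Kernel-checkable completeness of a table of primes (plan N1 of provefact `Literature.NumberTheory.LFunctions.robin_iff`, step (b))

Topic: `Literature/NumberTheory/LFunctions` (certified numerics for Robin's inequality along the
colossally abundant chain, `RobinAnalyticSharp.robinCA_below`). The envelope argument that bounds
`σ(m)/m^{1+ε}` for *all* `m` from data attached to the primes `q ≤ P` needs the table of primes to
be **complete** (no prime `≤ P` missing; spurious entries are harmless). This file provides a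
computable check `tableOK : List ℕ → Bool`, meant to be evaluated by the kernel (`decide +kernel`)
on a table shipped as packed prime gaps (`decodeChunks`: base-`256` digits of big numerals), and
PROVES its soundness:

* `tableOK_complete : tableOK ps = true → ∀ q prime, q ≤ ps.getLast → q ∈ ps`.

The check walks consecutive entries `p < p'` and finds, for every integer strictly between them, a
factor by trial division over the table itself (`firstFactor`, stopping at `q² > n`); since almost
every composite has a tiny factor, the cost is about `3` trial steps per integer (primes `< 10⁵`:
`≈ 1` minute of kernel time; larger ranges are to be split into segments). No primality of the
entries is proved or needed.

## References

* (method) Eratosthenes; for the use: G. Robin, J. Math. Pures Appl. 63 (1984), §3 (tables of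
  colossally abundant numbers). [Robin1984]
-/
namespace Literature.NumberTheory.LFunctions.PrimeTable

/-- Decode a big natural number into `len` base-`256` digits (least significant first), each read
as a prime gap; `decodeGaps start len code` returns the primes `start + g₁`, `start + g₁ + g₂`, ….
[folklore] -/
def decodeGaps : ℕ → ℕ → ℕ → List ℕ
  | _, 0, _ => []
  | start, len + 1, code =>
      let p := start + code % 256
      p :: decodeGaps p len (code / 256)

/-- Decode a list of chunks `(len, code)` starting after `start`. [folklore] -/
def decodeChunks : ℕ → List (ℕ × ℕ) → List ℕ
  | _, [] => []
  | start, (len, code) :: t =>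
      let l := decodeGaps start len code
      l ++ decodeChunks (l.getLastD start) t

/-- Trial division of `n` by the members of `ps` (in order) up to `√n`: returns a proper factor if
one is found before `q² > n`. [folklore] -/
def firstFactor : List ℕ → ℕ → Option ℕ
  | [], _ => none
  | q :: t, n => if n < q * q then none else if n % q = 0 then some q else firstFactor t n

/-- All of `p+1, …, p+c` have a factor in `ps` (found by `firstFactor`). [folklore] -/
def gapOK (ps : List ℕ) (p : ℕ) : ℕ → Bool
  | 0 => true
  | c + 1 => (firstFactor ps (p + c + 1)).isSome && gapOK ps p c

/-- The table check: consecutive entries `p < p'` with every integer strictly between them caught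
by trial division over the table itself. [folklore] -/
def chainOK (ps : List ℕ) : List ℕ → Bool
  | [] => true
  | [_] => true
  | p :: p' :: t => decide (p < p') && gapOK ps p (p' - p - 1) && chainOK ps (p' :: t)

/-- **The completeness check** for a table `ps`: it starts at `2` and passes `chainOK`. [folklore] -/
def tableOK (ps : List ℕ) : Bool :=
  match ps with
  | [] => false
  | p :: _ => (p == 2) && chainOK ps ps

/-! ### Soundness -/

/-- A factor found by `firstFactor` divides `n`, is a member of the list, and satisfies `q² ≤ n`.
[folklore] -/
theorem firstFactor_spec : ∀ (ps : List ℕ) (n q : ℕ), firstFactor ps n = some q →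
    q ∈ ps ∧ q ∣ n ∧ q * q ≤ n
  | [], n, q, h => by simp [firstFactor] at h
  | r :: t, n, q, h => by
      simp only [firstFactor] at h
      split_ifs at h with h1 h2
      · simp only [Option.some.injEq] at h
        subst h
        exact ⟨by simp, Nat.dvd_of_mod_eq_zero h2, not_lt.1 h1⟩
      · obtain ⟨hm, hd, hs⟩ := firstFactor_spec t n q h
        exact ⟨List.mem_cons_of_mem _ hm, hd, hs⟩

/-- If every table entry is `≥ 2`, a number caught by `firstFactor` is not prime. [folklore] -/
theorem not_prime_of_firstFactor {ps : List ℕ} (h2 : ∀ q ∈ ps, 2 ≤ q) {n q : ℕ}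
    (h : firstFactor ps n = some q) : ¬ n.Prime := by
  obtain ⟨hm, hd, hs⟩ := firstFactor_spec ps n q h
  have hq2 := h2 q hm
  intro hp
  have := (Nat.dvd_prime hp).1 hd
  rcases this with h1 | h1
  · omega
  · subst h1
    nlinarith

/-- `gapOK ps p c` catches every `n` with `p < n ≤ p + c`. [folklore] -/
theorem gapOK_spec (ps : List ℕ) (p : ℕ) : ∀ c : ℕ, gapOK ps p c = true →
    ∀ n, p < n → n ≤ p + c → (firstFactor ps n).isSome = true
  | 0, _, n, h1, h2 => by omega
  | c + 1, h, n, h1, h2 => by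
      simp only [gapOK, Bool.and_eq_true] at h
      rcases Nat.lt_or_ge n (p + c + 1) with hlt | hge
      · exact gapOK_spec ps p c h.2 n h1 (by omega)
      · have : n = p + c + 1 := by omega
        subst this
        exact h.1

/-- `chainOK` forces the list to be strictly increasing and every prime between its head and its
last element to be a member (given that all table entries are `≥ 2`). [folklore] -/
theorem chainOK_spec (ps : List ℕ) (h2 : ∀ q ∈ ps, 2 ≤ q) :
    ∀ (l : List ℕ) (a : ℕ), chainOK ps (a :: l) = true →
      ∀ q : ℕ, q.Prime → a ≤ q → q ≤ (a :: l).getLast (by simp) → q ∈ a :: l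
  | [], a, _, q, _, h1, h3 => by
      simp only [List.getLast_singleton] at h3
      have : q = a := le_antisymm h3 h1
      simp [this]
  | b :: t, a, h, q, hq, h1, h3 => by
      simp only [chainOK, Bool.and_eq_true, decide_eq_true_eq] at h
      obtain ⟨⟨hab, hgap⟩, hrest⟩ := h
      rcases Nat.lt_or_ge q b with hlt | hge
      · -- `a ≤ q < b`: either `q = a` or `q` is caught in the gap
        rcases eq_or_lt_of_le h1 with heq | hlt2
        · simp [heq]
        · exfalso
          have hc := gapOK_spec ps a (b - a - 1) hgap q hlt2 (by omega)
          obtain ⟨f, hf⟩ := Option.isSome_iff_exists.1 hc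
          exact not_prime_of_firstFactor h2 hf hq
      · have h3' : q ≤ (b :: t).getLast (by simp) := by
          simpa [List.getLast_cons] using h3
        have := chainOK_spec ps h2 t b hrest q hq hge h3'
        exact List.mem_cons_of_mem _ this

/-- All entries of a `chainOK` list starting at `a ≥ 2` are `≥ 2` (the list increases). [folklore] -/
theorem two_le_of_chainOK (ps : List ℕ) : ∀ (l : List ℕ) (a : ℕ), 2 ≤ a → chainOK ps (a :: l) = true →
    ∀ q ∈ a :: l, 2 ≤ q
  | [], a, ha, _, q, hq => by simp at hq; omega
  | b :: t, a, ha, h, q, hq => by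
      simp only [chainOK, Bool.and_eq_true, decide_eq_true_eq] at h
      rcases List.mem_cons.1 hq with h1 | h1
      · omega
      · exact two_le_of_chainOK ps t b (by omega) h.2 q h1

/-- **Soundness of `tableOK`**: every prime up to the last entry is in the table.
[folklore] -/
theorem tableOK_complete {ps : List ℕ} (h : tableOK ps = true) (hne : ps ≠ []) :
    ∀ q : ℕ, q.Prime → q ≤ ps.getLast hne → q ∈ ps := by
  match ps, h, hne with
  | a :: l, h, hne =>
    simp only [tableOK, Bool.and_eq_true, beq_iff_eq] at h
    obtain ⟨ha, hch⟩ := h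
    have h2 : ∀ q ∈ a :: l, 2 ≤ q := two_le_of_chainOK (a :: l) l a (by omega) hch
    intro q hq hql
    exact chainOK_spec (a :: l) h2 l a hch q hq (by rw [ha]; exact hq.two_le) hql

/-! ### Tests -/

/-- Auxiliary test data (proof-internal): the primes below `1000` as gaps, packed base `256`. [folklore] -/
def testChunks : List (ℕ × ℕ) := [(64, 212369213656111615623263926577988462865175155293273706504703056820171201570504874660926136258115261669611639251817444797680792886026732962566096484958466), (64, 525387209290966733983080434784114960061019474735705907132490571537478223470504826424444530859476565938006135970228642501275333244571816862991287445226498), (40, 50323703639674781993349456074132836335972873471174211881861251391952621900106346352957339338248)]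

example : tableOK (decodeChunks 0 testChunks) = true := by decide +kernel
example : (decodeChunks 0 testChunks).length = 168 := by decide +kernel

end Literature.NumberTheory.LFunctions.PrimeTable
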